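import Summits.BirchSwinnertonDyer.Rank1Residual.Additive.CensusX42ValBridges
import Summits.BirchSwinnertonDyer.Rank1Residual.Additive.GordChiBranchKatoComponent
import HarnessLib

/-!
# Rescaling the `p`-adic height datum, I: `Reg_p(E, c·Dh) = c^{rank}·Reg_p(E, Dh)`
# and the unit-invariance of every WINDOW-grade object of the X4-2 route
# (cell `b2b-bsdres`, census cell `bsd-formula-census`, seat `b2b-bsdres-census-ctyper1` =
# conjecture-typer 1, gen 8; sequels `CensusX42HeightPinning.lean`, `CensusX42ForallErratum.lean`)

HONEST FRAMING (cell `b2b-bsdres`, run/shared/lean/b2b/bsd-rank1-residual/, verbatim in every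
file): the goal of the cell is to DELETE the COMBINATION-SHAPED residual classes of the
Birch–Swinnerton-Dyer formula for ALL analytic-rank `≤ 1` elliptic curves over `ℚ` — "full BSD
formula for every rank `≤ 1` curve in class `C`" assembled STRICTLY from published theorems — so
that the rank-`≤ 1` remainder becomes exactly the CONSTRUCTION-SHAPED classes, which are TYPED
(missing-input `Prop`s), NOT attempted. This is not "finishing BSD". Census cell
(bsd-formula-census): research instrumentation; census output = EVIDENCE / conjecture items, never a
Literature fact; labels / RESIDUAL-MAP marks UNCHANGED (O7-ord OPEN; X3♯ / X4♯ CONSTRUCTION-SHAPED);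
nothing booked. Theorems only (no definition, no named fact); named facts enter only as hypotheses
of the predicates quoted.

## What

A `p`-adic height datum `Dh` on `E(ℚ)` (`PAdicHeightData W p`: a symmetric bilinear pairing into
`ℚ_p` killing torsion — its normalisation is NOT axiomatised, `PAdicHeights.lean`) can be RESCALED:
a datum `Dh'` with pairing `c · ⟨P,Q⟩_{Dh}` exists (`exists_pairing_eq_mul`; no definition is introduced —
every statement speaks of two data with `⟨,⟩_{Dh'} = c·⟨,⟩_{Dh}` pointwise; Mazur–Tate–Teitelbaum's analytic `λ`-height
`⟨P,Q⟩_λ = λ(i(P,Q))` is linear in the idele class character `λ`, Invent. Math. 84 (1986) Ch. II §4,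
pp. 31–32: replacing `λ` by `c·λ` replaces the height by `c` times it). §1 ([folklore] linear
algebra): `Reg_p(E, c·Dh) = c^{rank E(ℚ)} · Reg_p(E, Dh)` (`padicRegulator_eq_of_pairing_eq_mul` — Gram
determinant on the chosen Mordell–Weil basis, `Matrix.det_smul`, basis cardinality = rank by
`IsMordellWeilBasis.card_eq_holds`), so Schneider's non-degeneracy is invariant for `c ≠ 0` and the
NORM `‖Reg_p‖` (i.e. `ord_p Reg_p`) is invariant for `‖c‖ = 1`.

§2: every "up to a `p`-adic unit" object of the `r = 1` O7-ord route is invariant under `Dh ↦ u·Dh`,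
`u ∈ ℤ_p^×` — Delbourgo 2002 Thm. (B)'s clauses `LeadingTermClauses W p Dh`
(`leadingTermClauses_iff_of_pairing_eq_units_mul`), p01's / p07's typed branch `p`-adic Gross–Zagier inputs
`BranchPAdicGrossZagier[∅|Odd|Mult]At W p Dh` (`…_iff_of_pairing_eq_units_mul`), and this seat's
WINDOW-grade census relation `CensusX42.ValRelationAt W p Dh` (`valRelationAt_iff_of_pairing_eq_mul`, any `‖c‖ = 1`; in
fact `ValRelationAt` depends on `Dh` only through `‖Reg_p(E,Dh)‖`, `valRelationAt_of_norm_padicRegulator_eq`).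
So the two bookkeeping constants the cell's height READING carries — Delbourgo's degree factor
`[K:ℚ]⁻¹ = ½` in `⟨,⟩_{p,ℚ} := [K:ℚ]⁻¹⟨,⟩^{Sch}_{p,K}` (J. Number Theory 95 (2002) p. 39; a unit, `p`
odd) and the SIGN `κ_h = −1` between the census height and Delbourgo's regulator on the (M) rows
(RESIDUAL-MAP §D addendum 10 (2), from print: MTT86 Ch. II §§4–6 pp. 31–35 + Werner 1998 Thm. 7.2 /
Cor. 7.3; `κ_h = +1` on (G-ord, `e = 2`), addendum 9 (2): Mazur–Tate 1983 §(4.4), MST 2006 (1.1),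
Delbourgo 2002 pp. 38/67) — are INVISIBLE to every window-grade consumer (`CensusX42ValBridges` /
`ValUnitRows` / `ValConverse` / `ValLoops` / `ValCoeffValuation` and the n1011 `hGZ`-shaped class
theorems behind them). The EXACT-grade relation `RelationAt` is NOT invariant: it pins `Reg_p` on the
nose — `CensusX42HeightPinning.lean`; consequence (an ERRATUM on this seat's `∀ Dh`-packaged
exact-grade theorems): `CensusX42ForallErratum.lean`.

References: B. Mazur, J. Tate, J. Teitelbaum, Invent. Math. 84 (1986) Ch. II §4 (pp. 31–33)
[MazurTateTeitelbaum1986Invent]; D. Delbourgo, J. Number Theory 95 (2002) p. 39, Thm. (A)/(B) (p. 40)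
[Delbourgo2002]; D. Delbourgo, Compositio Math. 113 (1998) §2.5 BS-D(p) [Delbourgo1998]; P. Schneider,
Invent. Math. 69 (1982) §1 [Schneider1982PadicHeightI]; B. Mazur, W. Stein, J. Tate, Doc. Math. Extra
Vol. (2006) §1 [MazurSteinTate2006]; A. Werner, Doc. Math. 3 (1998) Thm. 7.2 / Cor. 7.3; HOME files
RESIDUAL-MAP.md §D addenda 9/10, `CensusX42LeadingTerm.lean` / `CensusX42ValRelation.lean` docstrings.
-/

set_option autoImplicit false

noncomputable section

open scoped Classical MatrixGroups ModularForm NumberField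

open CongruenceSubgroup WeierstrassCurve NumberField Literature.NumberTheory.EllipticCurves
  Literature.NumberTheory.EllipticCurves.ModularForms
  Literature.NumberTheory.EllipticCurves.Rank1Residual
  Literature.NumberTheory.EllipticCurves.Rank1Residual.Typed
  Literature.NumberTheory.EllipticCurves.Delbourgo2002
  Literature.NumberTheory.GaloisRepresentations
  Literature.Barriers.BirchSwinnertonDyer
  IsDedekindDomain

namespace Summit.BirchSwinnertonDyer.Rank1Residual.Additive

namespace CensusX42

variable {W : WeierstrassCurve ℚ} {p : ℕ} [hp : Fact p.Prime]


/-! ### §1 Rescaled height data: existence, Gram matrix, regulator -/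

omit hp in
/-- **The rescaled datum `c · Dh` EXISTS**: pairing `(P, Q) ↦ c · ⟨P, Q⟩_{Dh}` is again symmetric,
bilinear and kills torsion (MTT's analytic `λ`-height is linear in `λ`). No definition is introduced:
every statement below speaks of two data `Dh, Dh'` with `⟨P,Q⟩_{Dh'} = c · ⟨P,Q⟩_{Dh}` pointwise.
[cite: MazurTateTeitelbaum1986Invent, §II.4 (pp. 31–32)] -/
theorem exists_pairing_eq_mul [Fact p.Prime] (c : ℚ_[p]) (Dh : PAdicHeightData W p) :
    ∃ Dh' : PAdicHeightData W p, ∀ P Q, Dh'.pairing P Q = c * Dh.pairing P Q :=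
  ⟨{ pairing := Dh.pairing.compr₂ (AddMonoidHom.mulLeft c)
     symm := fun P Q ↦ by
       simp only [AddMonoidHom.compr₂_apply, AddMonoidHom.coe_mulLeft, Dh.symm P Q]
     map_torsion := fun P Q hP ↦ by
       simp only [AddMonoidHom.compr₂_apply, AddMonoidHom.coe_mulLeft, Dh.map_torsion P Q hP,
         mul_zero] },
    fun P Q ↦ by simp only [AddMonoidHom.compr₂_apply, AddMonoidHom.coe_mulLeft]⟩

omit hp in
/-- The relation read backwards: `⟨P,Q⟩_{Dh} = c⁻¹ · ⟨P,Q⟩_{Dh'}` (`c ≠ 0`). [folklore] -/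
theorem pairing_eq_inv_mul_of_pairing_eq_mul [Fact p.Prime] {Dh Dh' : PAdicHeightData W p} {c : ℚ_[p]}
    (hc0 : c ≠ 0) (hc : ∀ P Q, Dh'.pairing P Q = c * Dh.pairing P Q) :
    ∀ P Q, Dh.pairing P Q = c⁻¹ * Dh'.pairing P Q := fun P Q ↦ by
  rw [hc, ← mul_assoc, inv_mul_cancel₀ hc0, one_mul]

omit hp in
/-- The Gram matrix of `c · Dh` is `c` times that of `Dh`. [folklore] -/
theorem pairingMatrix_eq_smul_of_pairing_eq_mul [Fact p.Prime] {Dh Dh' : PAdicHeightData W p}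
    {c : ℚ_[p]} (hc : ∀ P Q, Dh'.pairing P Q = c * Dh.pairing P Q) {ι : Type*}
    (P : ι → W.toAffine.Point) : Dh'.pairingMatrix P = c • Dh.pairingMatrix P := by
  ext i j
  simp only [PAdicHeightData.pairingMatrix, Matrix.of_apply, Matrix.smul_apply, smul_eq_mul, hc]

omit hp in
/-- `det` of the rescaled Gram matrix: `Reg(c·Dh; P) = c^{#ι} · Reg(Dh; P)` (`Matrix.det_smul`). [folklore] -/
theorem padicRegulatorOf_eq_of_pairing_eq_mul [Fact p.Prime] {Dh Dh' : PAdicHeightData W p}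
    {c : ℚ_[p]} (hc : ∀ P Q, Dh'.pairing P Q = c * Dh.pairing P Q) {ι : Type*} [Fintype ι]
    (P : ι → W.toAffine.Point) :
    padicRegulatorOf Dh' P = c ^ Fintype.card ι * padicRegulatorOf Dh P := by
  unfold padicRegulatorOf
  rw [pairingMatrix_eq_smul_of_pairing_eq_mul hc, Matrix.det_smul]

/-- **`Reg_p(E, c·Dh) = c^{rank E(ℚ)} · Reg_p(E, Dh)`** — both regulators are Gram determinants on the
SAME chosen Mordell–Weil basis (`padicRegulator`), whose cardinality is the rank
(`IsMordellWeilBasis.card_eq_holds`); off the (never occurring) junk branch both are `0`.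
[cite: MazurTateTeitelbaum1986Invent, §II.4] -/
theorem padicRegulator_eq_of_pairing_eq_mul [W.IsElliptic] {Dh Dh' : PAdicHeightData W p}
    {c : ℚ_[p]} (hc : ∀ P Q, Dh'.pairing P Q = c * Dh.pairing P Q) :
    padicRegulator Dh' = c ^ W.mordellWeilRank * padicRegulator Dh := by
  unfold padicRegulator
  by_cases h : ∃ (n : ℕ) (P : Fin n → W.toAffine.Point), IsMordellWeilBasis P
  · have hn : Fintype.card (Fin h.choose) = W.mordellWeilRank :=
      IsMordellWeilBasis.card_eq_holds h.choose_spec.choose_spec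
    simp only [dif_pos h, padicRegulatorOf_eq_of_pairing_eq_mul hc, hn]
  · simp only [dif_neg h, mul_zero]

/-- Schneider's non-degeneracy is invariant under rescaling by `c ≠ 0`.
[cite: Schneider1982PadicHeightI, §1] -/
theorem schneiderConjecture_iff_of_pairing_eq_mul [W.IsElliptic] {Dh Dh' : PAdicHeightData W p}
    {c : ℚ_[p]} (hc0 : c ≠ 0) (hc : ∀ P Q, Dh'.pairing P Q = c * Dh.pairing P Q) :
    SchneiderConjecture Dh' ↔ SchneiderConjecture Dh := by
  simp only [SchneiderConjecture, padicRegulator_eq_of_pairing_eq_mul hc]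
  exact ⟨fun h h0 ↦ h (by rw [h0, mul_zero]), fun h ↦ mul_ne_zero (pow_ne_zero _ hc0) h⟩

/-- For `‖c‖ = 1` the regulator's NORM (equivalently `ord_p Reg_p`) is invariant. [folklore] -/
theorem norm_padicRegulator_eq_of_pairing_eq_mul [W.IsElliptic] {Dh Dh' : PAdicHeightData W p}
    {c : ℚ_[p]} (hc1 : ‖c‖ = 1) (hc : ∀ P Q, Dh'.pairing P Q = c * Dh.pairing P Q) :
    ‖padicRegulator Dh'‖ = ‖padicRegulator Dh‖ := by
  rw [padicRegulator_eq_of_pairing_eq_mul hc, norm_mul, norm_pow, hc1, one_pow, one_mul]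

/-- A unit of `ℤ_p` has norm `1` in `ℚ_p`. [folklore] -/
theorem norm_padicIntUnits_coe (u : ℤ_[p]ˣ) : ‖((u : ℤ_[p]) : ℚ_[p])‖ = 1 := by
  rw [PadicInt.padic_norm_e_of_padicInt]
  exact PadicInt.isUnit_iff.mp u.isUnit

/-- The unit relation read backwards: `⟨P,Q⟩_{Dh} = u⁻¹ · ⟨P,Q⟩_{Dh'}` (tree lemmas `coe_units_inv_eq_inv`,
`coe_units_ne_zero`). [folklore] -/
theorem pairing_eq_unitsInv_mul_of_pairing_eq_units_mul (u : ℤ_[p]ˣ) {Dh Dh' : PAdicHeightData W p}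
    (hc : ∀ P Q, Dh'.pairing P Q = ((u : ℤ_[p]) : ℚ_[p]) * Dh.pairing P Q) :
    ∀ P Q, Dh.pairing P Q = (((u⁻¹ : ℤ_[p]ˣ) : ℤ_[p]) : ℚ_[p]) * Dh'.pairing P Q := by
  rw [coe_units_inv_eq_inv]
  exact pairing_eq_inv_mul_of_pairing_eq_mul (coe_units_ne_zero p u) hc

/-! ### §2 The WINDOW-grade objects are invariant under rescaling by a unit -/

/-- Delbourgo's leading-term clauses for `u · Dh` give them for `Dh` (`u ∈ ℤ_p^×`; the factor
`u^{rank}` is absorbed into the clause's `∃ u ∈ ℤ_p^×`). [cite: Delbourgo2002, Theorem (B) (p. 40)] -/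
theorem leadingTermClauses_of_pairing_eq_units_mul [W.IsElliptic] (u : ℤ_[p]ˣ)
    {Dh Dh' : PAdicHeightData W p}
    (hc : ∀ P Q, Dh'.pairing P Q = ((u : ℤ_[p]) : ℚ_[p]) * Dh.pairing P Q)
    (h : LeadingTermClauses W p Dh') : LeadingTermClauses W p Dh := by
  have hu0 := coe_units_ne_zero p u
  intro κ γ hκ hγ hγ' D _ hX fE hf
  obtain ⟨h1, h2, h3⟩ := h κ γ hκ hγ hγ' D hX fE hf
  refine ⟨h1, ?_, ?_⟩
  · rw [schneiderConjecture_iff_of_pairing_eq_mul hu0 hc] at h2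
    exact h2
  · intro hS hfin
    obtain ⟨u0, ℓ, hℓ, hℓ1, heq⟩ := h3 ((schneiderConjecture_iff_of_pairing_eq_mul hu0 hc).mpr hS) hfin
    refine ⟨u0 * u ^ W.mordellWeilRank, ℓ, hℓ, hℓ1, ?_⟩
    rw [heq, padicRegulator_eq_of_pairing_eq_mul hc, Units.val_mul, Units.val_pow_eq_pow_val,
      PadicInt.coe_mul, PadicInt.coe_pow]
    ring

/-- **`LeadingTermClauses W p (u · Dh) ↔ LeadingTermClauses W p Dh`** for `u ∈ ℤ_p^×`: Delbourgo's
Theorem (B), an "up to a `p`-adic unit" statement, cannot tell `Dh` from `u · Dh` — in particular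
not from `−Dh`, nor from `½ · Dh` (`p` odd). [cite: Delbourgo2002, Theorem (B) (p. 40) and p. 39] -/
theorem leadingTermClauses_iff_of_pairing_eq_units_mul [W.IsElliptic] (u : ℤ_[p]ˣ)
    {Dh Dh' : PAdicHeightData W p}
    (hc : ∀ P Q, Dh'.pairing P Q = ((u : ℤ_[p]) : ℚ_[p]) * Dh.pairing P Q) :
    LeadingTermClauses W p Dh' ↔ LeadingTermClauses W p Dh :=
  ⟨leadingTermClauses_of_pairing_eq_units_mul u hc,
    leadingTermClauses_of_pairing_eq_units_mul u⁻¹ (pairing_eq_unitsInv_mul_of_pairing_eq_units_mul u hc)⟩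

/-- p01's typed even-branch `p`-adic Gross–Zagier for `u · Dh` gives it for `Dh` (`u ∈ ℤ_p^×`).
[cite: Delbourgo1998, §2.5 BS-D(p) (ii) (pp. 151–152) (shape only; nothing asserted)] -/
theorem branchPAdicGrossZagierAt_of_pairing_eq_units_mul [W.IsElliptic] (u : ℤ_[p]ˣ)
    {Dh Dh' : PAdicHeightData W p}
    (hc : ∀ P Q, Dh'.pairing P Q = ((u : ℤ_[p]) : ℚ_[p]) * Dh.pairing P Q)
    (h : BranchPAdicGrossZagierAt W p Dh') : BranchPAdicGrossZagierAt W p Dh := by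
  intro V _ _ N _ f hp4 hVW hord hf ϖ hϖ
  obtain ⟨u0, q, hL, heq⟩ := h V hp4 hVW hord hf ϖ hϖ
  refine ⟨u0 * u ^ W.mordellWeilRank, q, hL, ?_⟩
  rw [heq, padicRegulator_eq_of_pairing_eq_mul hc, Units.val_mul, Units.val_pow_eq_pow_val,
    PadicInt.coe_mul, PadicInt.coe_pow]
  ring

/-- **`BranchPAdicGrossZagierAt W p (u · Dh) ↔ BranchPAdicGrossZagierAt W p Dh`**, `u ∈ ℤ_p^×`.
[cite: Delbourgo1998, §2.5 BS-D(p) (ii) (pp. 151–152) (shape only; nothing asserted)] -/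
theorem branchPAdicGrossZagierAt_iff_of_pairing_eq_units_mul [W.IsElliptic] (u : ℤ_[p]ˣ)
    {Dh Dh' : PAdicHeightData W p}
    (hc : ∀ P Q, Dh'.pairing P Q = ((u : ℤ_[p]) : ℚ_[p]) * Dh.pairing P Q) :
    BranchPAdicGrossZagierAt W p Dh' ↔ BranchPAdicGrossZagierAt W p Dh :=
  ⟨branchPAdicGrossZagierAt_of_pairing_eq_units_mul u hc,
    branchPAdicGrossZagierAt_of_pairing_eq_units_mul u⁻¹
      (pairing_eq_unitsInv_mul_of_pairing_eq_units_mul u hc)⟩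

/-- The odd-branch twin for `u · Dh` gives it for `Dh` (`u ∈ ℤ_p^×`).
[cite: Delbourgo1998, §2.5 BS-D(p) (ii) (pp. 151–152) (shape only; nothing asserted)] -/
theorem branchPAdicGrossZagierOddAt_of_pairing_eq_units_mul [W.IsElliptic] (u : ℤ_[p]ˣ)
    {Dh Dh' : PAdicHeightData W p}
    (hc : ∀ P Q, Dh'.pairing P Q = ((u : ℤ_[p]) : ℚ_[p]) * Dh.pairing P Q)
    (h : BranchPAdicGrossZagierOddAt W p Dh') : BranchPAdicGrossZagierOddAt W p Dh := by
  intro V _ _ N _ f hp4 hVW hord hf ϖ hϖ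
  obtain ⟨u0, q, hL, heq⟩ := h V hp4 hVW hord hf ϖ hϖ
  refine ⟨u0 * u ^ W.mordellWeilRank, q, hL, ?_⟩
  rw [heq, padicRegulator_eq_of_pairing_eq_mul hc, Units.val_mul, Units.val_pow_eq_pow_val,
    PadicInt.coe_mul, PadicInt.coe_pow]
  ring

/-- **`BranchPAdicGrossZagierOddAt W p (u · Dh) ↔ BranchPAdicGrossZagierOddAt W p Dh`**, `u ∈ ℤ_p^×`.
[cite: Delbourgo1998, §2.5 BS-D(p) (ii) (pp. 151–152) (shape only; nothing asserted)] -/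
theorem branchPAdicGrossZagierOddAt_iff_of_pairing_eq_units_mul [W.IsElliptic] (u : ℤ_[p]ˣ)
    {Dh Dh' : PAdicHeightData W p}
    (hc : ∀ P Q, Dh'.pairing P Q = ((u : ℤ_[p]) : ℚ_[p]) * Dh.pairing P Q) :
    BranchPAdicGrossZagierOddAt W p Dh' ↔ BranchPAdicGrossZagierOddAt W p Dh :=
  ⟨branchPAdicGrossZagierOddAt_of_pairing_eq_units_mul u hc,
    branchPAdicGrossZagierOddAt_of_pairing_eq_units_mul u⁻¹
      (pairing_eq_unitsInv_mul_of_pairing_eq_units_mul u hc)⟩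

/-- The (M) twin (p07's potentially multiplicative branch `p`-adic Gross–Zagier) for `u · Dh` gives it
for `Dh` (`u ∈ ℤ_p^×`). [cite: Delbourgo1998, §2.5 BS-D(p) (ii) (pp. 151–152) (shape only; nothing asserted)] -/
theorem branchPAdicGrossZagierMultAt_of_pairing_eq_units_mul [W.IsElliptic] (u : ℤ_[p]ˣ)
    {Dh Dh' : PAdicHeightData W p}
    (hc : ∀ P Q, Dh'.pairing P Q = ((u : ℤ_[p]) : ℚ_[p]) * Dh.pairing P Q)
    (h : BranchPAdicGrossZagierMultAt W p Dh') : BranchPAdicGrossZagierMultAt W p Dh := by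
  intro V _ _ N _ f B hp2 hVW hB hf ϖ hϖ
  obtain ⟨u0, q, hL, heq⟩ := h V B hp2 hVW hB hf ϖ hϖ
  refine ⟨u0 * u ^ W.mordellWeilRank, q, hL, ?_⟩
  rw [heq, padicRegulator_eq_of_pairing_eq_mul hc, Units.val_mul, Units.val_pow_eq_pow_val,
    PadicInt.coe_mul, PadicInt.coe_pow]
  ring

/-- **`BranchPAdicGrossZagierMultAt W p (u · Dh) ↔ BranchPAdicGrossZagierMultAt W p Dh`**, `u ∈ ℤ_p^×`.
[cite: Delbourgo1998, §2.5 BS-D(p) (ii) (pp. 151–152) (shape only; nothing asserted)] -/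
theorem branchPAdicGrossZagierMultAt_iff_of_pairing_eq_units_mul [W.IsElliptic] (u : ℤ_[p]ˣ)
    {Dh Dh' : PAdicHeightData W p}
    (hc : ∀ P Q, Dh'.pairing P Q = ((u : ℤ_[p]) : ℚ_[p]) * Dh.pairing P Q) :
    BranchPAdicGrossZagierMultAt W p Dh' ↔ BranchPAdicGrossZagierMultAt W p Dh :=
  ⟨branchPAdicGrossZagierMultAt_of_pairing_eq_units_mul u hc,
    branchPAdicGrossZagierMultAt_of_pairing_eq_units_mul u⁻¹
      (pairing_eq_unitsInv_mul_of_pairing_eq_units_mul u hc)⟩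

omit hp in
/-- Bookkeeping: `‖a · R' · b‖ = ‖a · R · b‖` once `‖R'‖ = ‖R‖`. [folklore] -/
private theorem norm_mul_mul_congr [Fact p.Prime] {a b R R' : ℚ_[p]} (h : ‖R'‖ = ‖R‖) :
    ‖a * R' * b‖ = ‖a * R * b‖ := by
  rw [norm_mul, norm_mul, h, ← norm_mul, ← norm_mul]

/-- **The WINDOW-grade census relation depends on `Dh` only through `‖Reg_p(E,Dh)‖`**: two data with
regulators of the same norm satisfy `ValRelationAt` together.
[cite: Delbourgo1998, §2.5 BS-D(p) (i)(ii) (pp. 151–152) (shape only; nothing asserted)] -/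
theorem valRelationAt_of_norm_padicRegulator_eq [W.IsElliptic] [W.IsGloballyMinimal]
    {Dh Dh' : PAdicHeightData W p} (hReg : ‖padicRegulator Dh'‖ = ‖padicRegulator Dh‖)
    (h : ValRelationAt W p Dh) : ValRelationAt W p Dh' := by
  intro V _ _ C N _ f hadd hV hf hr s hs
  obtain ⟨heven, hodd⟩ := h V C f hadd hV hf hr s hs
  refine ⟨fun h1 hC ϖ hϖ ↦ ?_, fun h3 hC ϖ hϖ ↦ ?_⟩
  · obtain ⟨hG, hM⟩ := heven h1 hC ϖ hϖ
    refine ⟨fun hord ↦ ?_, fun hmult ↦ ?_⟩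
    · obtain ⟨h0, hne, hn⟩ := hG hord
      exact ⟨h0, hne, hn.trans (norm_mul_mul_congr hReg).symm⟩
    · obtain ⟨h0, hne, hn⟩ := hM hmult
      exact ⟨h0, hne, hn.trans (norm_mul_mul_congr hReg).symm⟩
  · obtain ⟨hG, hM⟩ := hodd h3 hC ϖ hϖ
    refine ⟨fun hord ↦ ?_, fun hmult ↦ ?_⟩
    · obtain ⟨h0, hne, hn⟩ := hG hord
      exact ⟨h0, hne, hn.trans (norm_mul_mul_congr hReg).symm⟩
    · obtain ⟨h0, hne, hn⟩ := hM hmult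
      exact ⟨h0, hne, hn.trans (norm_mul_mul_congr hReg).symm⟩

/-- **`ValRelationAt W p (c · Dh) ↔ ValRelationAt W p Dh` for every `c` with `‖c‖ = 1`** — the typed
X4-2 WINDOW relation (`v_p(A′) = v_p(h) + v_p(#Ш_an∏c/#T²)`, X42-WINDOW.md 429/429) is blind to any
`p`-adic unit in the height: to the sign `κ_h = −1` of the (M) height reading (RESIDUAL-MAP §D
addendum 10 (2)) and to Delbourgo's `[K:ℚ]⁻¹ = ½` alike.
[cite: Delbourgo1998, §2.5 BS-D(p) (i)(ii) (pp. 151–152) (shape only; nothing asserted)]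
[cite: Delbourgo2002, p. 39 (⟨,⟩_{p,ℚ} := [K:ℚ]⁻¹⟨,⟩^{Sch}_{p,K})] -/
theorem valRelationAt_iff_of_pairing_eq_mul [W.IsElliptic] [W.IsGloballyMinimal]
    {Dh Dh' : PAdicHeightData W p} {c : ℚ_[p]} (hc1 : ‖c‖ = 1)
    (hc : ∀ P Q, Dh'.pairing P Q = c * Dh.pairing P Q) :
    ValRelationAt W p Dh' ↔ ValRelationAt W p Dh :=
  ⟨valRelationAt_of_norm_padicRegulator_eq (norm_padicRegulator_eq_of_pairing_eq_mul hc1 hc).symm,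
    valRelationAt_of_norm_padicRegulator_eq (norm_padicRegulator_eq_of_pairing_eq_mul hc1 hc)⟩

/-- The `∀ Dh` WINDOW-grade packaging is rescaling-stable: if `∀ Dh, LeadingTermClauses → ValRelationAt`,
a (B)-datum `Dh` and `Dh' = u · Dh` (`u ∈ ℤ_p^×`), then `Dh'` is again a (B)-datum AND satisfies the
window relation — no new constraint appears (contrast the EXACT grade, `CensusX42ForallErratum.lean`).
[cite: Delbourgo2002, Theorem (B) (p. 40)] -/
theorem valRelationAt_of_forall_of_pairing_eq_units_mul [W.IsElliptic] [W.IsGloballyMinimal]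
    (u : ℤ_[p]ˣ) (hrel : ∀ Dh : PAdicHeightData W p, LeadingTermClauses W p Dh → ValRelationAt W p Dh)
    {Dh Dh' : PAdicHeightData W p} (hB : LeadingTermClauses W p Dh)
    (hc : ∀ P Q, Dh'.pairing P Q = ((u : ℤ_[p]) : ℚ_[p]) * Dh.pairing P Q) :
    LeadingTermClauses W p Dh' ∧ ValRelationAt W p Dh' :=
  have hB' := (leadingTermClauses_iff_of_pairing_eq_units_mul u hc).mpr hB
  ⟨hB', hrel Dh' hB'⟩

end CensusX42

end Summit.BirchSwinnertonDyer.Rank1Residual.Additive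

end
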